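import Mathlib
import Summits.AtomisticToContinuum.Crystallization.Theses.PhononSlackCertificates
import Summits.AtomisticToContinuum.Crystallization.Theorems.PhononSlackCertificatesNearFieldConvexityStubPnfOfLocalCertificate8
import Summits.AtomisticToContinuum.Crystallization.Theorems.PhononSlackCertificatesNearFieldConvexityStubTubeCount
import Summits.AtomisticToContinuum.Crystallization.Theorems.PhononSlackCertificatesNearFieldConvexityStubSelfSiteFloor
import Summits.AtomisticToContinuum.Crystallization.Theorems.PhononSlackCertificatesNearFieldConvexityStubCruxOfPureNearField
import Summits.AtomisticToContinuum.Crystallization.Theorems.PhononSlackCertificatesNearFieldConvexityStubPairCountOfCrossing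

/-!
# Interior coercivity SPLIT BY REGIME (crux `PhononSlackCertificates.NearFieldConvexity`, stmt-13958, line `Sketch`, v21)

Skeleton v21 (lead c4) cuts the summed energy stub of v20 along the perturbative / non-perturbative seam identified in the
line card (§c4-2, analysis A4: at the handover tolerance `1/20` the near field is non-perturbative, while at a SMALL
goodness tolerance it is the perturbative Cauchy–Born / W^{1,∞} regime of E–Ming and Ortner–Theil):

* (I) `stub_perturbativeCoercivity` — there is a tolerance `ε₁ ∈ (0, 1/20]` such that summed interior coercivity holds
  on sets of `ε₁`-GOOD particles (measured against `e*`; a prover compares with any periodic reference `e(Q) ≥ e*`):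
  `c·#{i ∈ int₈Ω : not η-layered} ≤ [E_self(Ω) − |Ω|e*] + C·#∂₄Ω`;
* (II) `stub_roughSitesPaid` — for EVERY `ε₁ ∈ (0, 1/20]`, inside a set of `1/20`-good particles the particles that are
  not even `ε₁`-good are paid for linearly by the excess: `#{i ∈ Ω : ¬ ε₁-good} ≤ K·[E_self(Ω) − |Ω|e*] + C·#∂₄Ω`, `K ≥ 0`
  (the non-perturbative "no cheap rough sites" statement).

This file proves the composition `interiorCoercivity_of_split` ((I) + (II) ⇒ the summed interior coercivity for sets
of `1/20`-good particles, `e*`-form) by excising the rough set `D = {i ∈ Ω : ¬ ε₁-good}`: on `Ω' = Ω ∖ D` apply (I);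
`#NL(int₈Ω) ≤ #NL(int₈Ω') + #{i ∈ Ω : some d ∈ D within 8}`, `#∂₄Ω' ≤ #∂₄Ω + #{i ∈ Ω : some d ∈ D within 4}`, both
`≤ K_R·#D` by the ball count of the `171/200`-separated good particles (`pairCount_card_ball`, `pairCount_sep_of_good`);
`E_self(Ω') ≤ E_self(Ω) + (250/6)δ⁻⁶·#D` by the partial-site-energy floor (`selfSiteFloor_neg_le_partialSiteEnergy`) and
`e* ≤ 0`; then (II) bounds `#D`.  It also proves `pnf_of_interiorCoercivityEStar` (the `e*`-form analogue of the landed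
`pnf_of_interiorCoercivity`) and the registered composition `stub_pnfOfSplit : pair count → charts → (I) → (II) → PNF`.
All `[folklore]`.
-/

noncomputable section

open scoped BigOperators
open Literature.MathematicalPhysics.StatisticalMechanics Literature.Geometry.DiscreteGeometry

namespace Summit.AtomisticToContinuum.Crystallization.Theorems.PhononSlackNearFieldConvexity

/-! ### Counting near a removed set -/

/-- **Neighbourhood count.**  In a set `Ω` of `1/20`-good particles, the particles within `R ≥ 0` of some member of
`D` number at most `(400R/171 + 1)³·#D` (good particles are `171/200`-separated). [folklore] -/
theorem card_near_removed_le {N : ℕ} (x : Fin N → EuclideanSpace ℝ (Fin 3)) (Ω D : Finset (Fin N))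
    (hΩ : ∀ i ∈ Ω, IsTwoShellGood (1 / 20) (47 / 50) 1 x i) {R : ℝ} (hR : 0 ≤ R) :
    ((Ω.filter fun i => ∃ d ∈ D, dist (x d) (x i) ≤ R).card : ℝ) ≤ (2 * R / (171 / 200) + 1) ^ 3 * (D.card : ℝ) := by
  classical
  have hsub : (Ω.filter fun i => ∃ d ∈ D, dist (x d) (x i) ≤ R) ⊆
      D.biUnion (fun d => Ω.filter fun i => dist (x i) (x d) ≤ R) := by
    intro i hi
    rw [Finset.mem_filter] at hi
    obtain ⟨d, hd, hdist⟩ := hi.2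
    rw [Finset.mem_biUnion]
    exact ⟨d, hd, Finset.mem_filter.2 ⟨hi.1, by rwa [dist_comm]⟩⟩
  have h1 : ((Ω.filter fun i => ∃ d ∈ D, dist (x d) (x i) ≤ R).card : ℝ) ≤
      ∑ d ∈ D, ((Ω.filter fun i => dist (x i) (x d) ≤ R).card : ℝ) := by
    have := (Finset.card_le_card hsub).trans Finset.card_biUnion_le
    exact_mod_cast this
  have h2 : ∀ d ∈ D, ((Ω.filter fun i => dist (x i) (x d) ≤ R).card : ℝ) ≤ (2 * R / (171 / 200) + 1) ^ 3 := by
    intro d _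
    refine pairCount_card_ball x _ (by norm_num) ?_ (x d) hR (fun i hi => (Finset.mem_filter.1 hi).2)
    intro i hi j hj hij
    exact pairCount_sep_of_good x (hΩ i (Finset.mem_filter.1 hi).1) j (Ne.symm hij)
  calc ((Ω.filter fun i => ∃ d ∈ D, dist (x d) (x i) ≤ R).card : ℝ)
      ≤ ∑ d ∈ D, ((Ω.filter fun i => dist (x i) (x d) ≤ R).card : ℝ) := h1
    _ ≤ ∑ d ∈ D, (2 * R / (171 / 200) + 1) ^ 3 := Finset.sum_le_sum h2
    _ = (2 * R / (171 / 200) + 1) ^ 3 * (D.card : ℝ) := by rw [Finset.sum_const, nsmul_eq_mul, mul_comm]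

/-! ### Self-energy of a sub-cluster -/

/-- **Sub-cluster self-energy.**  Removing `D ⊆ Ω` from a `δ`-separated cluster raises the self-energy by at most
`(250/6)δ⁻⁶` per removed particle: `E_self(Ω ∖ D) ≤ E_self(Ω) + (250/6)δ⁻⁶·#D`. [folklore] -/
theorem selfEnergy_sdiff_le {N : ℕ} (x : Fin N → EuclideanSpace ℝ (Fin 3)) {δ : ℝ} (hδ : 0 < δ)
    (hsep : ∀ i j : Fin N, i ≠ j → δ ≤ dist (x i) (x j)) (Ω D : Finset (Fin N)) (hD : D ⊆ Ω) :
    (∑ i ∈ Ω \ D, (1 / 2 : ℝ) * (∑ j ∈ (Ω \ D).erase i, lennardJones (dist (x i) (x j)))) ≤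
      (∑ i ∈ Ω, (1 / 2 : ℝ) * (∑ j ∈ Ω.erase i, lennardJones (dist (x i) (x j)))) + 250 / 6 * δ⁻¹ ^ 6 * (D.card : ℝ) := by
  classical
  set Ω' := Ω \ D with hΩ'
  -- split the outer sum of `E_self(Ω)` into `Ω'` and `D`
  have hsplitΩ : (∑ i ∈ Ω, (1 / 2 : ℝ) * (∑ j ∈ Ω.erase i, lennardJones (dist (x i) (x j)))) =
      (∑ i ∈ Ω', (1 / 2 : ℝ) * (∑ j ∈ Ω.erase i, lennardJones (dist (x i) (x j)))) +
        ∑ i ∈ D, (1 / 2 : ℝ) * (∑ j ∈ Ω.erase i, lennardJones (dist (x i) (x j))) := by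
    rw [hΩ', Finset.sum_sdiff hD]
  -- split the inner sums at `i ∈ Ω'`: `Ω.erase i = Ω'.erase i ∪ D` (disjoint)
  have hinner : ∀ i ∈ Ω', ∑ j ∈ Ω.erase i, lennardJones (dist (x i) (x j)) =
      (∑ j ∈ Ω'.erase i, lennardJones (dist (x i) (x j))) + ∑ j ∈ D, lennardJones (dist (x i) (x j)) := by
    intro i hi
    have hiD : i ∉ D := (Finset.mem_sdiff.1 hi).2
    have hdisj : Disjoint (Ω'.erase i) D := by
      rw [Finset.disjoint_left]
      intro j hj hjD
      exact (Finset.mem_sdiff.1 (Finset.mem_of_mem_erase hj)).2 hjD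
    have hunion : Ω.erase i = Ω'.erase i ∪ D := by
      ext j
      simp only [Finset.mem_erase, Finset.mem_union, hΩ', Finset.mem_sdiff]
      constructor
      · rintro ⟨hji, hjΩ⟩
        by_cases hjD : j ∈ D
        · exact Or.inr hjD
        · exact Or.inl ⟨hji, hjΩ, hjD⟩
      · rintro (⟨hji, hjΩ, -⟩ | hjD)
        · exact ⟨hji, hjΩ⟩
        · exact ⟨fun h => hiD (h ▸ hjD), hD hjD⟩
    rw [hunion, Finset.sum_union hdisj]
  -- floors
  have hfloorD : ∀ i ∈ D, -(250 / 6 * δ⁻¹ ^ 6) ≤ ∑ j ∈ Ω.erase i, lennardJones (dist (x i) (x j)) :=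
    fun i _ => selfSiteFloor_neg_le_partialSiteEnergy x hδ hsep Ω i
  have hfloorX : ∀ j ∈ D, -(250 / 6 * δ⁻¹ ^ 6) ≤ ∑ i ∈ Ω', lennardJones (dist (x i) (x j)) := by
    intro j hj
    have hjΩ' : j ∉ Ω' := fun h => (Finset.mem_sdiff.1 h).2 hj
    have h := selfSiteFloor_neg_le_partialSiteEnergy x hδ hsep (insert j Ω') j
    rw [Finset.erase_insert hjΩ'] at h
    calc -(250 / 6 * δ⁻¹ ^ 6) ≤ ∑ i ∈ Ω', lennardJones (dist (x j) (x i)) := h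
      _ = ∑ i ∈ Ω', lennardJones (dist (x i) (x j)) := Finset.sum_congr rfl fun i _ => by rw [dist_comm]
  have hcross : -(250 / 6 * δ⁻¹ ^ 6 * (D.card : ℝ)) ≤ ∑ i ∈ Ω', ∑ j ∈ D, lennardJones (dist (x i) (x j)) := by
    rw [Finset.sum_comm]
    have := Finset.sum_le_sum hfloorX
    rw [Finset.sum_const, nsmul_eq_mul] at this
    linarith
  have hDsum : -(250 / 6 * δ⁻¹ ^ 6 * (D.card : ℝ)) ≤ ∑ i ∈ D, ∑ j ∈ Ω.erase i, lennardJones (dist (x i) (x j)) := by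
    have := Finset.sum_le_sum hfloorD
    rw [Finset.sum_const, nsmul_eq_mul] at this
    linarith
  -- assemble
  have hE' : (∑ i ∈ Ω', (1 / 2 : ℝ) * (∑ j ∈ Ω'.erase i, lennardJones (dist (x i) (x j)))) =
      (∑ i ∈ Ω', (1 / 2 : ℝ) * (∑ j ∈ Ω.erase i, lennardJones (dist (x i) (x j)))) -
        (1 / 2 : ℝ) * ∑ i ∈ Ω', ∑ j ∈ D, lennardJones (dist (x i) (x j)) := by
    rw [Finset.mul_sum, ← Finset.sum_sub_distrib]
    refine Finset.sum_congr rfl fun i hi => ?_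
    rw [hinner i hi]
    ring
  have hDhalf : ∑ i ∈ D, (1 / 2 : ℝ) * (∑ j ∈ Ω.erase i, lennardJones (dist (x i) (x j))) =
      (1 / 2 : ℝ) * ∑ i ∈ D, ∑ j ∈ Ω.erase i, lennardJones (dist (x i) (x j)) := by rw [Finset.mul_sum]
  rw [hE', hsplitΩ, hDhalf]
  nlinarith [hcross, hDsum]

/-! ### PNF from the `e*`-form of interior coercivity -/

/-- **PNF from summed interior coercivity, `e*`-form** (the analogue of the landed `pnf_of_interiorCoercivity` with
the reference energy `e*` itself). [folklore] -/
theorem pnf_of_interiorCoercivityEStar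
    (hpc : ∀ δ : ℝ, 0 < δ → ∃ C : ℝ, ∀ (N : ℕ) (x : Fin N → EuclideanSpace ℝ (Fin 3)), (∀ i j : Fin N, i ≠ j → δ ≤ dist (x i) (x j)) → ∀ Ω : Finset (Fin N), (∀ i ∈ Ω, IsTwoShellGood (1 / 20) (47 / 50) 1 x i) → ∀ ℓ : ℝ, 4 ≤ ℓ → (∑ i ∈ Ω.filter (fun i => ∀ j : Fin N, dist (x j) (x i) ≤ 4 → j ∈ Ω), ((Finset.univ.filter (fun j => j ∉ Ω ∧ dist (x i) (x j) < 2 * ℓ)).card : ℝ)) ≤ C * ℓ ^ 4 * (Nat.card {i : Fin N // i ∈ Ω ∧ ∃ j : Fin N, j ∉ Ω ∧ dist (x j) (x i) ≤ 4} : ℝ))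
    (hchart : ∀ (N : ℕ) (x : Fin N → EuclideanSpace ℝ (Fin 3)) (Ω : Finset (Fin N)), (∀ i ∈ Ω, IsTwoShellGood (1 / 20) (47 / 50) 1 x i) → ∀ i ∈ Ω, (∀ k : Fin N, dist (x k) (x i) ≤ 3 → k ∈ Ω) → (∃ (A : EuclideanSpace ℝ (Fin 3) →ₗᵢ[ℝ] EuclideanSpace ℝ (Fin 3)) (a h : ℝ) (s : ℤ → ℤ), 47 / 50 ≤ a ∧ a ≤ 1 ∧ 39 / 50 * a ≤ h ∧ h ≤ 17 / 20 * a ∧ IsHaggSeq s ∧ (fun S : Set (EuclideanSpace ℝ (Fin 3)) => (∀ j : Fin N, dist (x j) (x i) ≤ 2 → ∃ p ∈ S, dist (x j) p ≤ 2 / 5) ∧ (∀ p ∈ S, dist p (x i) ≤ 2 → ∃ j : Fin N, dist (x j) p ≤ 2 / 5)) {p | ∃ m u v : ℤ, p = x i + A (((u : ℝ) • triangularVec₁ a) + ((v : ℝ) • triangularVec₂ a) + ((haggLabel s m : ℝ) • barlowOffset a) + ((m : ℝ) • layerNormal h))}))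
    (hIC : ∀ δ : ℝ, 0 < δ → ∀ η : ℝ, 0 < η → ∃ c : ℝ, 0 < c ∧ ∃ C : ℝ, ∀ (N : ℕ) (x : Fin N → EuclideanSpace ℝ (Fin 3)), (∀ i j : Fin N, i ≠ j → δ ≤ dist (x i) (x j)) → ∀ Ω : Finset (Fin N), (∀ i ∈ Ω, IsTwoShellGood (1 / 20) (47 / 50) 1 x i) → (∀ i ∈ Ω, (∀ k : Fin N, dist (x k) (x i) ≤ 3 → k ∈ Ω) → (∃ (A : EuclideanSpace ℝ (Fin 3) →ₗᵢ[ℝ] EuclideanSpace ℝ (Fin 3)) (a h : ℝ) (s : ℤ → ℤ), 47 / 50 ≤ a ∧ a ≤ 1 ∧ 39 / 50 * a ≤ h ∧ h ≤ 17 / 20 * a ∧ IsHaggSeq s ∧ (fun S : Set (EuclideanSpace ℝ (Fin 3)) => (∀ j : Fin N, dist (x j) (x i) ≤ 2 → ∃ p ∈ S, dist (x j) p ≤ 2 / 5) ∧ (∀ p ∈ S, dist p (x i) ≤ 2 → ∃ j : Fin N, dist (x j) p ≤ 2 / 5)) {p | ∃ m u v : ℤ, p = x i + A (((u : ℝ)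 • triangularVec₁ a) + ((v : ℝ) • triangularVec₂ a) + ((haggLabel s m : ℝ) • barlowOffset a) + ((m : ℝ) • layerNormal h))})) → c * (Nat.card {i : Fin N // i ∈ Ω ∧ ((∀ k : Fin N, dist (x k) (x i) ≤ 8 → k ∈ Ω) ∧ ¬ (∃ (A : EuclideanSpace ℝ (Fin 3) →ₗᵢ[ℝ] EuclideanSpace ℝ (Fin 3)) (t : EuclideanSpace ℝ (Fin 3)) (a : ℝ) (s : ℤ → ℤ) (z : ℤ → ℝ), 47 / 50 ≤ a ∧ a ≤ 1 ∧ IsHaggSeq s ∧ (∀ m : ℤ, 39 / 50 * a ≤ z (m + 1) - z m ∧ z (m + 1) - z m ≤ 17 / 20 * a) ∧ (fun S : Set (EuclideanSpace ℝ (Fin 3)) => (∀ j : Fin N, dist (x j) (x i) ≤ 2 → ∃ p ∈ S, dist (x j + t) p ≤ η) ∧ (∀ p ∈ S, dist p (x i + t) ≤ 2 → ∃ j : Fin N, dist (x j + t) p ≤ η)) {p | ∃ m i j : ℤ, p = A (((i : ℝ) • triangularVec₁ a) + ((j : ℝ) • triangularVec₂ a) + ((haggLabel s m : ℝ) • barlowOffset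 a) + (z m • layerNormal 1))}))} : ℝ) ≤ ((∑ i ∈ Ω, (1 / 2 : ℝ) * (∑ j ∈ Ω.erase i, lennardJones (dist (x i) (x j)))) - (Ω.card : ℝ) * (⨅ Q : PeriodicConfiguration 3, Q.energyPerParticle lennardJones)) + C * (Nat.card {i : Fin N // i ∈ Ω ∧ ∃ j : Fin N, j ∉ Ω ∧ dist (x j) (x i) ≤ 4} : ℝ)) :
    ∀ δ : ℝ, 0 < δ → ∀ η : ℝ, 0 < η → ∃ c : ℝ, 0 < c ∧ ∃ C : ℝ, ∀ (N : ℕ) (x : Fin N → EuclideanSpace ℝ (Fin 3)), (∀ i j : Fin N, i ≠ j → δ ≤ dist (x i) (x j)) → ∀ Ω : Finset (Fin N), (∀ i ∈ Ω, IsTwoShellGood (1 / 20) (47 / 50) 1 x i) → c * (Nat.card {i : Fin N // i ∈ Ω ∧ ¬ (∃ (A : EuclideanSpace ℝ (Fin 3) →ₗᵢ[ℝ] EuclideanSpace ℝ (Fin 3)) (t : EuclideanSpace ℝ (Fin 3)) (a : ℝ) (s : ℤ → ℤ) (z : ℤ → ℝ), 47 / 50 ≤ a ∧ a ≤ 1 ∧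 IsHaggSeq s ∧ (∀ m : ℤ, 39 / 50 * a ≤ z (m + 1) - z m ∧ z (m + 1) - z m ≤ 17 / 20 * a) ∧ (fun S : Set (EuclideanSpace ℝ (Fin 3)) => (∀ j : Fin N, dist (x j) (x i) ≤ 2 → ∃ p ∈ S, dist (x j + t) p ≤ η) ∧ (∀ p ∈ S, dist p (x i + t) ≤ 2 → ∃ j : Fin N, dist (x j + t) p ≤ η)) {p | ∃ m i j : ℤ, p = A (((i : ℝ) • triangularVec₁ a) + ((j : ℝ) • triangularVec₂ a) + ((haggLabel s m : ℝ) • barlowOffset a) + (z m • layerNormal 1))})} : ℝ) - C * (Nat.card {i : Fin N // i ∈ Ω ∧ ∃ j : Fin N, j ∉ Ω ∧ dist (x j) (x i) ≤ 4} : ℝ) ≤ (∑ i ∈ Ω, (1 / 2 : ℝ) * (∑ j ∈ Ω.erase i, lennardJones (dist (x i) (x j)))) - (Ω.card : ℝ) * (⨅ Q : PeriodicConfiguration 3, Q.energyPerParticle lennardJones) := by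
  intro δ hδ η hη
  obtain ⟨c, hc, C, hC⟩ := hIC δ hδ η hη
  obtain ⟨Cp, hCp⟩ := hpc δ hδ
  set K : ℝ := 1 + |Cp| * (17 / 4 : ℝ) ^ 4 with hKdef
  refine ⟨c, hc, C + c * K, ?_⟩
  intro N x hsep Ω hΩ
  classical
  have key := hC N x hsep Ω hΩ (fun i hi h3 => hchart N x Ω hΩ i hi h3)
  set NLp : Fin N → Prop := fun i : Fin N => ¬ (∃ (A : EuclideanSpace ℝ (Fin 3) →ₗᵢ[ℝ] EuclideanSpace ℝ (Fin 3)) (t : EuclideanSpace ℝ (Fin 3)) (a : ℝ) (s : ℤ → ℤ) (z : ℤ → ℝ), 47 / 50 ≤ a ∧ a ≤ 1 ∧ IsHaggSeq s ∧ (∀ m : ℤ, 39 / 50 * a ≤ z (m + 1) - z m ∧ z (m + 1) - z m ≤ 17 / 20 * a) ∧ (fun S : Set (EuclideanSpace ℝ (Fin 3)) => (∀ j : Fin N, dist (x j) (x i) ≤ 2 → ∃ p ∈ S, dist (x j + t) p ≤ η) ∧ (∀ p ∈ S, dist p (x i + t) ≤ 2 → ∃ j : Fin N, dist (x j + t) p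 ≤ η)) {p | ∃ m i j : ℤ, p = A (((i : ℝ) • triangularVec₁ a) + ((j : ℝ) • triangularVec₂ a) + ((haggLabel s m : ℝ) • barlowOffset a) + (z m • layerNormal 1))}) with hNLp
  set I8p : Fin N → Prop := fun i => ∀ k : Fin N, dist (x k) (x i) ≤ 8 → k ∈ Ω with hI8p
  set B8 : Finset (Fin N) := Ω.filter (fun i => ∃ j : Fin N, j ∉ Ω ∧ dist (x j) (x i) ≤ 8) with hB8
  have hsplit : ((Ω.filter NLp).card : ℝ) ≤ ((Ω.filter fun i => I8p i ∧ NLp i).card : ℝ) + (B8.card : ℝ) := by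
    have hsub : Ω.filter NLp ⊆ (Ω.filter fun i => I8p i ∧ NLp i) ∪ B8 := by
      intro i hi
      rw [Finset.mem_filter] at hi
      rw [Finset.mem_union]
      by_cases h8 : I8p i
      · exact Or.inl (Finset.mem_filter.2 ⟨hi.1, h8, hi.2⟩)
      · refine Or.inr (Finset.mem_filter.2 ⟨hi.1, ?_⟩)
        by_contra hne
        exact h8 (fun k hk => by_contra fun hkΩ => hne ⟨k, hkΩ, hk⟩)
    exact_mod_cast (Finset.card_le_card hsub).trans (Finset.card_union_le _ _)
  have hcol := collar8_card_le x Ω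
  have hpair := hCp N x hsep Ω hΩ (17 / 4) (by norm_num)
  rw [lc_natCard_eq] at hpair
  set B4c : ℝ := ((Ω.filter fun i => ∃ j : Fin N, j ∉ Ω ∧ dist (x j) (x i) ≤ 4).card : ℝ) with hB4c
  have hB40 : 0 ≤ B4c := Nat.cast_nonneg _
  have hBle : (B8.card : ℝ) ≤ K * B4c := by
    have h1 : (B8.card : ℝ) ≤ B4c + Cp * (17 / 4 : ℝ) ^ 4 * B4c := by
      have := hcol
      rw [← hB8] at this
      linarith
    have h2 : Cp * (17 / 4 : ℝ) ^ 4 * B4c ≤ |Cp| * (17 / 4 : ℝ) ^ 4 * B4c :=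
      mul_le_mul_of_nonneg_right (mul_le_mul_of_nonneg_right (le_abs_self Cp) (by positivity)) hB40
    rw [hKdef]
    nlinarith
  rw [lc_natCard_eq, lc_natCard_eq]
  rw [lc_natCard_eq, lc_natCard_eq] at key
  have hK0 : 0 ≤ K := by rw [hKdef]; positivity
  have hcK : 0 ≤ c * K := mul_nonneg hc.le hK0
  have hstep : c * ((Ω.filter NLp).card : ℝ) ≤ c * ((Ω.filter fun i => I8p i ∧ NLp i).card : ℝ) + c * K * B4c := by
    have := mul_le_mul_of_nonneg_left hsplit hc.le
    nlinarith [mul_le_mul_of_nonneg_left hBle hc.le]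
  nlinarith [key, hstep, hB40, hcK]

/-! ### The split -/

/-- **Interior coercivity from the regime split (I) + (II).** [folklore] -/
theorem interiorCoercivity_of_split
    (hI : ∃ ε₁ : ℝ, 0 < ε₁ ∧ ε₁ ≤ 1 / 20 ∧ ∀ δ : ℝ, 0 < δ → ∀ η : ℝ, 0 < η → ∃ c : ℝ, 0 < c ∧ ∃ C : ℝ, ∀ (N : ℕ) (x : Fin N → EuclideanSpace ℝ (Fin 3)), (∀ i j : Fin N, i ≠ j → δ ≤ dist (x i) (x j)) → ∀ Ω : Finset (Fin N), (∀ i ∈ Ω, IsTwoShellGood (ε₁) (47 / 50) 1 x i) → (∀ i ∈ Ω, (∀ k : Fin N, dist (x k) (x i) ≤ 3 → k ∈ Ω) → (∃ (A : EuclideanSpace ℝ (Fin 3) →ₗᵢ[ℝ] EuclideanSpace ℝ (Fin 3)) (a h : ℝ) (s : ℤ → ℤ), 47 / 50 ≤ a ∧ a ≤ 1 ∧ 39 / 50 * a ≤ h ∧ h ≤ 17 / 20 * a ∧ IsHaggSeq s ∧ (fun S : Set (EuclideanSpace ℝ (Fin 3)) => (∀ j : Fin N, dist (x j) (x i) ≤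 2 → ∃ p ∈ S, dist (x j) p ≤ 2 / 5) ∧ (∀ p ∈ S, dist p (x i) ≤ 2 → ∃ j : Fin N, dist (x j) p ≤ 2 / 5)) {p | ∃ m u v : ℤ, p = x i + A (((u : ℝ) • triangularVec₁ a) + ((v : ℝ) • triangularVec₂ a) + ((haggLabel s m : ℝ) • barlowOffset a) + ((m : ℝ) • layerNormal h))})) → c * (Nat.card {i : Fin N // i ∈ Ω ∧ ((∀ k : Fin N, dist (x k) (x i) ≤ 8 → k ∈ Ω) ∧ ¬ (∃ (A : EuclideanSpace ℝ (Fin 3) →ₗᵢ[ℝ] EuclideanSpace ℝ (Fin 3)) (t : EuclideanSpace ℝ (Fin 3)) (a : ℝ) (s : ℤ → ℤ) (z : ℤ → ℝ), 47 / 50 ≤ a ∧ a ≤ 1 ∧ IsHaggSeq s ∧ (∀ m : ℤ, 39 / 50 * a ≤ z (m + 1) - z m ∧ z (m + 1) - z m ≤ 17 / 20 * a) ∧ (fun S : Set (EuclideanSpace ℝ (Fin 3)) => (∀ j : Fin N, dist (x j) (x i) ≤ 2 → ∃ p ∈ S, dist (x j + t) p ≤ η) ∧ (∀ p ∈ S,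 dist p (x i + t) ≤ 2 → ∃ j : Fin N, dist (x j + t) p ≤ η)) {p | ∃ m i j : ℤ, p = A (((i : ℝ) • triangularVec₁ a) + ((j : ℝ) • triangularVec₂ a) + ((haggLabel s m : ℝ) • barlowOffset a) + (z m • layerNormal 1))}))} : ℝ) ≤ ((∑ i ∈ Ω, (1 / 2 : ℝ) * (∑ j ∈ Ω.erase i, lennardJones (dist (x i) (x j)))) - (Ω.card : ℝ) * (⨅ Q : PeriodicConfiguration 3, Q.energyPerParticle lennardJones)) + C * (Nat.card {i : Fin N // i ∈ Ω ∧ ∃ j : Fin N, j ∉ Ω ∧ dist (x j) (x i) ≤ 4} : ℝ))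
    (hII : ∀ ε₁ : ℝ, 0 < ε₁ → ε₁ ≤ 1 / 20 → ∀ δ : ℝ, 0 < δ → ∃ K : ℝ, 0 ≤ K ∧ ∃ C : ℝ, ∀ (N : ℕ) (x : Fin N → EuclideanSpace ℝ (Fin 3)), (∀ i j : Fin N, i ≠ j → δ ≤ dist (x i) (x j)) → ∀ Ω : Finset (Fin N), (∀ i ∈ Ω, IsTwoShellGood (1 / 20) (47 / 50) 1 x i) → (∀ i ∈ Ω, (∀ k : Fin N, dist (x k) (x i) ≤ 3 → k ∈ Ω) → (∃ (A : EuclideanSpace ℝ (Fin 3) →ₗᵢ[ℝ] EuclideanSpace ℝ (Fin 3)) (a h : ℝ) (s : ℤ → ℤ), 47 / 50 ≤ a ∧ a ≤ 1 ∧ 39 / 50 * a ≤ h ∧ h ≤ 17 / 20 * a ∧ IsHaggSeq s ∧ (fun S : Set (EuclideanSpace ℝ (Fin 3)) => (∀ j : Fin N, dist (x j) (x i) ≤ 2 → ∃ p ∈ S, dist (x j) p ≤ 2 / 5) ∧ (∀ p ∈ S, dist p (x i) ≤ 2 → ∃ j : Fin N, dist (x j) p ≤ 2 / 5)) {p | ∃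 m u v : ℤ, p = x i + A (((u : ℝ) • triangularVec₁ a) + ((v : ℝ) • triangularVec₂ a) + ((haggLabel s m : ℝ) • barlowOffset a) + ((m : ℝ) • layerNormal h))})) → (Nat.card {i : Fin N // i ∈ Ω ∧ ¬ IsTwoShellGood ε₁ (47 / 50) 1 x i} : ℝ) ≤ K * ((∑ i ∈ Ω, (1 / 2 : ℝ) * (∑ j ∈ Ω.erase i, lennardJones (dist (x i) (x j)))) - (Ω.card : ℝ) * (⨅ Q : PeriodicConfiguration 3, Q.energyPerParticle lennardJones)) + C * (Nat.card {i : Fin N // i ∈ Ω ∧ ∃ j : Fin N, j ∉ Ω ∧ dist (x j) (x i) ≤ 4} : ℝ)) :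
    ∀ δ : ℝ, 0 < δ → ∀ η : ℝ, 0 < η → ∃ c : ℝ, 0 < c ∧ ∃ C : ℝ, ∀ (N : ℕ) (x : Fin N → EuclideanSpace ℝ (Fin 3)), (∀ i j : Fin N, i ≠ j → δ ≤ dist (x i) (x j)) → ∀ Ω : Finset (Fin N), (∀ i ∈ Ω, IsTwoShellGood (1 / 20) (47 / 50) 1 x i) → (∀ i ∈ Ω, (∀ k : Fin N, dist (x k) (x i) ≤ 3 → k ∈ Ω) → (∃ (A : EuclideanSpace ℝ (Fin 3) →ₗᵢ[ℝ] EuclideanSpace ℝ (Fin 3)) (a h : ℝ) (s : ℤ → ℤ), 47 / 50 ≤ a ∧ a ≤ 1 ∧ 39 / 50 * a ≤ h ∧ h ≤ 17 / 20 * a ∧ IsHaggSeq s ∧ (fun S : Set (EuclideanSpace ℝ (Fin 3)) => (∀ j : Fin N, dist (x j) (x i) ≤ 2 → ∃ p ∈ S, dist (x j) p ≤ 2 / 5) ∧ (∀ p ∈ S, dist p (x i) ≤ 2 → ∃ j : Fin N, dist (x j) p ≤ 2 / 5)) {p | ∃ m u v : ℤ, p = x i + A (((u : ℝ) • triangularVec₁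 a) + ((v : ℝ) • triangularVec₂ a) + ((haggLabel s m : ℝ) • barlowOffset a) + ((m : ℝ) • layerNormal h))})) → c * (Nat.card {i : Fin N // i ∈ Ω ∧ ((∀ k : Fin N, dist (x k) (x i) ≤ 8 → k ∈ Ω) ∧ ¬ (∃ (A : EuclideanSpace ℝ (Fin 3) →ₗᵢ[ℝ] EuclideanSpace ℝ (Fin 3)) (t : EuclideanSpace ℝ (Fin 3)) (a : ℝ) (s : ℤ → ℤ) (z : ℤ → ℝ), 47 / 50 ≤ a ∧ a ≤ 1 ∧ IsHaggSeq s ∧ (∀ m : ℤ, 39 / 50 * a ≤ z (m + 1) - z m ∧ z (m + 1) - z m ≤ 17 / 20 * a) ∧ (fun S : Set (EuclideanSpace ℝ (Fin 3)) => (∀ j : Fin N, dist (x j) (x i) ≤ 2 → ∃ p ∈ S, dist (x j + t) p ≤ η) ∧ (∀ p ∈ S, dist p (x i + t) ≤ 2 → ∃ j : Fin N, dist (x j + t) p ≤ η)) {p | ∃ m i j : ℤ, p = A (((i : ℝ) • triangularVec₁ a) + ((j : ℝ) • triangularVec₂ a) + ((haggLabel s m : ℝ) • barlowOffset a) + (z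 m • layerNormal 1))}))} : ℝ) ≤ ((∑ i ∈ Ω, (1 / 2 : ℝ) * (∑ j ∈ Ω.erase i, lennardJones (dist (x i) (x j)))) - (Ω.card : ℝ) * (⨅ Q : PeriodicConfiguration 3, Q.energyPerParticle lennardJones)) + C * (Nat.card {i : Fin N // i ∈ Ω ∧ ∃ j : Fin N, j ∉ Ω ∧ dist (x j) (x i) ≤ 4} : ℝ) := by
  obtain ⟨ε₁, hε₁, hε₁', hIc⟩ := hI
  intro δ hδ η hη
  obtain ⟨c, hc, Cp, hCp⟩ := hIc δ hδ η hη
  obtain ⟨Kr, hKr, Cr, hCr⟩ := hII ε₁ hε₁ hε₁' δ hδ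
  -- constants
  set K8 : ℝ := (2 * 8 / (171 / 200) + 1) ^ 3 with hK8
  set K4 : ℝ := (2 * 4 / (171 / 200) + 1) ^ 3 with hK4
  set M : ℝ := 250 / 6 * δ⁻¹ ^ 6 + |Cp| * K4 + c * K8 with hM
  have hM0 : 0 ≤ M := by rw [hM]; positivity
  have hden : 0 < 1 + M * Kr := by nlinarith [mul_nonneg hM0 hKr]
  refine ⟨c / (1 + M * Kr), div_pos hc hden, (|Cp| + M * |Cr|) / (1 + M * Kr), ?_⟩
  intro N x hsep Ω hΩ hchart
  classical
  -- the rough set and the smooth sub-cluster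
  set D : Finset (Fin N) := Ω.filter (fun i => ¬ IsTwoShellGood ε₁ (47 / 50) 1 x i) with hDdef
  set Ω' : Finset (Fin N) := Ω \ D with hΩ'def
  have hDΩ : D ⊆ Ω := Finset.filter_subset _ _
  have hΩ'Ω : Ω' ⊆ Ω := Finset.sdiff_subset
  have hΩ'good : ∀ i ∈ Ω', IsTwoShellGood ε₁ (47 / 50) 1 x i := by
    intro i hi
    obtain ⟨hiΩ, hiD⟩ := Finset.mem_sdiff.1 hi
    by_contra h
    exact hiD (Finset.mem_filter.2 ⟨hiΩ, h⟩)
  have hΩ'chart : (∀ i ∈ Ω', (∀ k : Fin N, dist (x k) (x i) ≤ 3 → k ∈ Ω') → (∃ (A : EuclideanSpace ℝ (Fin 3) →ₗᵢ[ℝ] EuclideanSpace ℝ (Fin 3)) (a h : ℝ) (s : ℤ → ℤ), 47 / 50 ≤ a ∧ a ≤ 1 ∧ 39 / 50 * a ≤ h ∧ h ≤ 17 / 20 * a ∧ IsHaggSeq s ∧ (fun S : Set (EuclideanSpace ℝ (Fin 3)) => (∀ j : Fin N, dist (x j) (x i) ≤ 2 → ∃ p ∈ S, dist (x j) p ≤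 2 / 5) ∧ (∀ p ∈ S, dist p (x i) ≤ 2 → ∃ j : Fin N, dist (x j) p ≤ 2 / 5)) {p | ∃ m u v : ℤ, p = x i + A (((u : ℝ) • triangularVec₁ a) + ((v : ℝ) • triangularVec₂ a) + ((haggLabel s m : ℝ) • barlowOffset a) + ((m : ℝ) • layerNormal h))})) := by
    intro i hi h3
    exact hchart i (hΩ'Ω hi) (fun k hk => hΩ'Ω (h3 k hk))
  -- (I) on `Ω'` and (II) on `Ω`
  have hIapp := hCp N x hsep Ω' hΩ'good hΩ'chart
  have hIIapp := hCr N x hsep Ω hΩ hchart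
  -- abbreviations for the counts
  set NLp : Fin N → Prop := fun i : Fin N => ¬ (∃ (A : EuclideanSpace ℝ (Fin 3) →ₗᵢ[ℝ] EuclideanSpace ℝ (Fin 3)) (t : EuclideanSpace ℝ (Fin 3)) (a : ℝ) (s : ℤ → ℤ) (z : ℤ → ℝ), 47 / 50 ≤ a ∧ a ≤ 1 ∧ IsHaggSeq s ∧ (∀ m : ℤ, 39 / 50 * a ≤ z (m + 1) - z m ∧ z (m + 1) - z m ≤ 17 / 20 * a) ∧ (fun S : Set (EuclideanSpace ℝ (Fin 3)) => (∀ j : Fin N, dist (x j) (x i) ≤ 2 → ∃ p ∈ S, dist (x j + t) p ≤ η) ∧ (∀ p ∈ S, dist p (x i + t) ≤ 2 → ∃ j : Fin N, dist (x j + t) p ≤ η)) {p | ∃ m i j : ℤ, p = A (((i : ℝ) • triangularVec₁ a) + ((j : ℝ) • triangularVec₂ a) + ((haggLabel s m : ℝ) • barlowOffset a) + (z m • layerNormal 1))}) with hNLp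
  have hNL : ((Ω.filter fun i => (∀ k : Fin N, dist (x k) (x i) ≤ 8 → k ∈ Ω) ∧ NLp i).card : ℝ) ≤
      ((Ω'.filter fun i => (∀ k : Fin N, dist (x k) (x i) ≤ 8 → k ∈ Ω') ∧ NLp i).card : ℝ) +
        ((Ω.filter fun i => ∃ d ∈ D, dist (x d) (x i) ≤ 8).card : ℝ) := by
    have hsub : (Ω.filter fun i => (∀ k : Fin N, dist (x k) (x i) ≤ 8 → k ∈ Ω) ∧ NLp i) ⊆
        (Ω'.filter fun i => (∀ k : Fin N, dist (x k) (x i) ≤ 8 → k ∈ Ω') ∧ NLp i) ∪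
          (Ω.filter fun i => ∃ d ∈ D, dist (x d) (x i) ≤ 8) := by
      intro i hi
      obtain ⟨hiΩ, h8, hnl⟩ := Finset.mem_filter.1 hi
      rw [Finset.mem_union]
      by_cases hnear : ∃ d ∈ D, dist (x d) (x i) ≤ 8
      · exact Or.inr (Finset.mem_filter.2 ⟨hiΩ, hnear⟩)
      · push Not at hnear
        have h8' : ∀ k : Fin N, dist (x k) (x i) ≤ 8 → k ∈ Ω' := by
          intro k hk
          refine Finset.mem_sdiff.2 ⟨h8 k hk, fun hkD => ?_⟩
          exact absurd hk (not_le.2 (hnear k hkD))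
        have hiΩ' : i ∈ Ω' := h8' i (by rw [dist_self]; norm_num)
        exact Or.inl (Finset.mem_filter.2 ⟨hiΩ', h8', hnl⟩)
    exact_mod_cast (Finset.card_le_card hsub).trans (Finset.card_union_le _ _)
  have hB4 : ((Ω'.filter fun i => ∃ j : Fin N, j ∉ Ω' ∧ dist (x j) (x i) ≤ 4).card : ℝ) ≤
      ((Ω.filter fun i => ∃ j : Fin N, j ∉ Ω ∧ dist (x j) (x i) ≤ 4).card : ℝ) +
        ((Ω.filter fun i => ∃ d ∈ D, dist (x d) (x i) ≤ 4).card : ℝ) := by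
    have hsub : (Ω'.filter fun i => ∃ j : Fin N, j ∉ Ω' ∧ dist (x j) (x i) ≤ 4) ⊆
        (Ω.filter fun i => ∃ j : Fin N, j ∉ Ω ∧ dist (x j) (x i) ≤ 4) ∪
          (Ω.filter fun i => ∃ d ∈ D, dist (x d) (x i) ≤ 4) := by
      intro i hi
      obtain ⟨hiΩ', j, hjΩ', hd⟩ := Finset.mem_filter.1 hi
      have hiΩ := hΩ'Ω hiΩ'
      rw [Finset.mem_union]
      by_cases hjΩ : j ∈ Ω
      · refine Or.inr (Finset.mem_filter.2 ⟨hiΩ, j, ?_, hd⟩)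
        by_contra hjD
        exact hjΩ' (Finset.mem_sdiff.2 ⟨hjΩ, hjD⟩)
      · exact Or.inl (Finset.mem_filter.2 ⟨hiΩ, j, hjΩ, hd⟩)
    exact_mod_cast (Finset.card_le_card hsub).trans (Finset.card_union_le _ _)
  have hnear8 := card_near_removed_le x Ω D hΩ (by norm_num : (0 : ℝ) ≤ 8)
  have hnear4 := card_near_removed_le x Ω D hΩ (by norm_num : (0 : ℝ) ≤ 4)
  rw [← hK8] at hnear8
  rw [← hK4] at hnear4
  -- energies
  have hEself := selfEnergy_sdiff_le x hδ hsep Ω D hDΩ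
  have heneg : (⨅ Q : PeriodicConfiguration 3, Q.energyPerParticle lennardJones) ≤ 0 := by
    have h' : (⨅ Q : PeriodicConfiguration 3, Q.energyPerParticle lennardJones) ≤ -1 / 2 :=
      Summit.AtomisticToContinuum.Crystallization.Theorems.LayeredLawsSelectHcp.Negative.Threshold.eStar_le_neg_half
    linarith
  have hcardΩ' : ((Ω'.card : ℕ) : ℝ) = (Ω.card : ℝ) - (D.card : ℝ) := by
    rw [hΩ'def, Finset.card_sdiff_of_subset hDΩ, Nat.cast_sub (Finset.card_le_card hDΩ)]
  have hfloorΩ := pureNearField_self_floor x hδ hsep Ω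
  -- rewrite all `Nat.card`s as filter cards
  rw [lc_natCard_eq, lc_natCard_eq]
  rw [lc_natCard_eq, lc_natCard_eq] at hIapp
  rw [lc_natCard_eq, lc_natCard_eq] at hIIapp
  have hDcard : ((Ω.filter fun i => ¬ IsTwoShellGood ε₁ (47 / 50) 1 x i).card : ℝ) = (D.card : ℝ) := by
    rw [hDdef]
  rw [hDcard] at hIIapp
  -- notation for the real quantities
  set nl : ℝ := ((Ω.filter fun i => (∀ k : Fin N, dist (x k) (x i) ≤ 8 → k ∈ Ω) ∧ NLp i).card : ℝ) with hnl
  set nl' : ℝ := ((Ω'.filter fun i => (∀ k : Fin N, dist (x k) (x i) ≤ 8 → k ∈ Ω') ∧ NLp i).card : ℝ) with hnl'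
  set b4 : ℝ := ((Ω.filter fun i => ∃ j : Fin N, j ∉ Ω ∧ dist (x j) (x i) ≤ 4).card : ℝ) with hb4
  set b4' : ℝ := ((Ω'.filter fun i => ∃ j : Fin N, j ∉ Ω' ∧ dist (x j) (x i) ≤ 4).card : ℝ) with hb4'
  set d : ℝ := (D.card : ℝ) with hd
  set ex : ℝ := (∑ i ∈ Ω, (1 / 2 : ℝ) * (∑ j ∈ Ω.erase i, lennardJones (dist (x i) (x j)))) - (Ω.card : ℝ) * (⨅ Q : PeriodicConfiguration 3, Q.energyPerParticle lennardJones) with hex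
  set ex' : ℝ := (∑ i ∈ Ω', (1 / 2 : ℝ) * (∑ j ∈ Ω'.erase i, lennardJones (dist (x i) (x j)))) - (Ω'.card : ℝ) * (⨅ Q : PeriodicConfiguration 3, Q.energyPerParticle lennardJones) with hex'
  have hd0 : 0 ≤ d := Nat.cast_nonneg _
  have hb40 : 0 ≤ b4 := Nat.cast_nonneg _
  have hb4'0 : 0 ≤ b4' := Nat.cast_nonneg _
  have hnl'0 : 0 ≤ nl' := Nat.cast_nonneg _
  have hex0 : 0 ≤ ex := by rw [hex]; linarith
  -- (e) excess of the sub-cluster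
  have hexle : ex' ≤ ex + 250 / 6 * δ⁻¹ ^ 6 * d := by
    rw [hex', hex, hcardΩ']
    nlinarith [hEself, mul_nonneg hd0 (neg_nonneg.2 heneg)]
  -- (I): `c·nl' ≤ ex' + Cp·b4'`, hence with `|Cp|`
  have hI' : c * nl' ≤ ex' + |Cp| * b4' := by
    have : Cp * b4' ≤ |Cp| * b4' := mul_le_mul_of_nonneg_right (le_abs_self Cp) hb4'0
    linarith [hIapp]
  -- (II): `d ≤ Kr·ex + Cr·b4`
  have hII' : d ≤ Kr * ex + |Cr| * b4 := by
    have : Cr * b4 ≤ |Cr| * b4 := mul_le_mul_of_nonneg_right (le_abs_self Cr) hb40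
    linarith [hIIapp]
  -- chain
  have h1a := mul_le_mul_of_nonneg_left hNL hc.le
  have h1b := mul_le_mul_of_nonneg_left hnear8 hc.le
  have h1 : c * nl ≤ c * nl' + c * K8 * d := by linarith [h1a, h1b]
  have h2a := mul_le_mul_of_nonneg_left hB4 (abs_nonneg Cp)
  have h2b := mul_le_mul_of_nonneg_left hnear4 (abs_nonneg Cp)
  have h2 : |Cp| * b4' ≤ |Cp| * b4 + |Cp| * K4 * d := by linarith [h2a, h2b]
  have hMd : M * d = 250 / 6 * δ⁻¹ ^ 6 * d + |Cp| * K4 * d + c * K8 * d := by rw [hM]; ring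
  have hchain : c * nl ≤ ex + |Cp| * b4 + M * d := by
    rw [hMd]
    calc c * nl ≤ c * nl' + c * K8 * d := h1
      _ ≤ (ex' + |Cp| * b4') + c * K8 * d := add_le_add hI' le_rfl
      _ ≤ (ex + 250 / 6 * δ⁻¹ ^ 6 * d + (|Cp| * b4 + |Cp| * K4 * d)) + c * K8 * d :=
          add_le_add (add_le_add hexle h2) le_rfl
      _ = ex + |Cp| * b4 + (250 / 6 * δ⁻¹ ^ 6 * d + |Cp| * K4 * d + c * K8 * d) := by ring
  have hfinal : c * nl ≤ (1 + M * Kr) * ex + (|Cp| + M * |Cr|) * b4 := by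
    have hMII : M * d ≤ M * Kr * ex + M * |Cr| * b4 := by
      have := mul_le_mul_of_nonneg_left hII' hM0
      have e : M * (Kr * ex + |Cr| * b4) = M * Kr * ex + M * |Cr| * b4 := by ring
      rw [e] at this
      exact this
    have e2 : (1 + M * Kr) * ex + (|Cp| + M * |Cr|) * b4 = ex + M * Kr * ex + |Cp| * b4 + M * |Cr| * b4 := by ring
    rw [e2]
    linarith [hchain, hMII]
  -- divide by `1 + M·Kr`
  rw [div_mul_eq_mul_div, div_le_iff₀ hden]
  have hrhs : (ex + (|Cp| + M * |Cr|) / (1 + M * Kr) * b4) * (1 + M * Kr) =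
      (1 + M * Kr) * ex + (|Cp| + M * |Cr|) * b4 := by
    field_simp
  rw [hrhs]
  exact hfinal

/-- **Registered composition `stub_pnfOfInteriorCoercivityEStar` (skeleton v21)**: charts at radius-3 interior sites →
summed interior coercivity (`e*`-form) → PNF; the pair count is the landed `stub_pairCountOfCrossing`.  The regime split
`interiorCoercivity_of_split` above supplies the second hypothesis from the two registered stubs (I), (II). [folklore] -/
theorem stub_pnfOfInteriorCoercivityEStar : (∀ (N : ℕ) (x : Fin N → EuclideanSpace ℝ (Fin 3)) (Ω : Finset (Fin N)), (∀ i ∈ Ω, IsTwoShellGood (1 / 20) (47 / 50) 1 x i) → ∀ i ∈ Ω, (∀ k : Fin N, dist (x k) (x i) ≤ 3 → k ∈ Ω) → (∃ (A : EuclideanSpace ℝ (Fin 3) →ₗᵢ[ℝ] EuclideanSpace ℝ (Fin 3)) (a h : ℝ) (s : ℤ → ℤ), 47 / 50 ≤ a ∧ a ≤ 1 ∧ 39 / 50 * a ≤ h ∧ h ≤ 17 / 20 * a ∧ IsHaggSeq s ∧ (fun S : Set (EuclideanSpace ℝ (Fin 3)) => (∀ j : Fin N, dist (x j) (x i) ≤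 2 → ∃ p ∈ S, dist (x j) p ≤ 2 / 5) ∧ (∀ p ∈ S, dist p (x i) ≤ 2 → ∃ j : Fin N, dist (x j) p ≤ 2 / 5)) {p | ∃ m u v : ℤ, p = x i + A (((u : ℝ) • triangularVec₁ a) + ((v : ℝ) • triangularVec₂ a) + ((haggLabel s m : ℝ) • barlowOffset a) + ((m : ℝ) • layerNormal h))})) → (∀ δ : ℝ, 0 < δ → ∀ η : ℝ, 0 < η → ∃ c : ℝ, 0 < c ∧ ∃ C : ℝ, ∀ (N : ℕ) (x : Fin N → EuclideanSpace ℝ (Fin 3)), (∀ i j : Fin N, i ≠ j → δ ≤ dist (x i) (x j)) → ∀ Ω : Finset (Fin N), (∀ i ∈ Ω, IsTwoShellGood (1 / 20) (47 / 50) 1 x i) → (∀ i ∈ Ω, (∀ k : Fin N, dist (x k) (x i) ≤ 3 → k ∈ Ω) → (∃ (A : EuclideanSpace ℝ (Fin 3) →ₗᵢ[ℝ] EuclideanSpace ℝ (Fin 3)) (a h : ℝ) (s : ℤ → ℤ), 47 / 50 ≤ a ∧ a ≤ 1 ∧ 39 / 50 * a ≤ h ∧ h ≤ 17 / 20 * a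 ∧ IsHaggSeq s ∧ (fun S : Set (EuclideanSpace ℝ (Fin 3)) => (∀ j : Fin N, dist (x j) (x i) ≤ 2 → ∃ p ∈ S, dist (x j) p ≤ 2 / 5) ∧ (∀ p ∈ S, dist p (x i) ≤ 2 → ∃ j : Fin N, dist (x j) p ≤ 2 / 5)) {p | ∃ m u v : ℤ, p = x i + A (((u : ℝ) • triangularVec₁ a) + ((v : ℝ) • triangularVec₂ a) + ((haggLabel s m : ℝ) • barlowOffset a) + ((m : ℝ) • layerNormal h))})) → c * (Nat.card {i : Fin N // i ∈ Ω ∧ ((∀ k : Fin N, dist (x k) (x i) ≤ 8 → k ∈ Ω) ∧ ¬ (∃ (A : EuclideanSpace ℝ (Fin 3) →ₗᵢ[ℝ] EuclideanSpace ℝ (Fin 3)) (t : EuclideanSpace ℝ (Fin 3)) (a : ℝ) (s : ℤ → ℤ) (z : ℤ → ℝ), 47 / 50 ≤ a ∧ a ≤ 1 ∧ IsHaggSeq s ∧ (∀ m : ℤ, 39 / 50 * a ≤ z (m + 1) - z m ∧ z (m + 1) - z m ≤ 17 / 20 * a) ∧ (fun S : Set (EuclideanSpace ℝ (Fin 3))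 => (∀ j : Fin N, dist (x j) (x i) ≤ 2 → ∃ p ∈ S, dist (x j + t) p ≤ η) ∧ (∀ p ∈ S, dist p (x i + t) ≤ 2 → ∃ j : Fin N, dist (x j + t) p ≤ η)) {p | ∃ m i j : ℤ, p = A (((i : ℝ) • triangularVec₁ a) + ((j : ℝ) • triangularVec₂ a) + ((haggLabel s m : ℝ) • barlowOffset a) + (z m • layerNormal 1))}))} : ℝ) ≤ ((∑ i ∈ Ω, (1 / 2 : ℝ) * (∑ j ∈ Ω.erase i, lennardJones (dist (x i) (x j)))) - (Ω.card : ℝ) * (⨅ Q : PeriodicConfiguration 3, Q.energyPerParticle lennardJones)) + C * (Nat.card {i : Fin N // i ∈ Ω ∧ ∃ j : Fin N, j ∉ Ω ∧ dist (x j) (x i) ≤ 4} : ℝ)) → ∀ δ : ℝ, 0 < δ → ∀ η : ℝ, 0 < η → ∃ c : ℝ, 0 < c ∧ ∃ C : ℝ, ∀ (N : ℕ) (x : Fin N → EuclideanSpace ℝ (Fin 3)), (∀ i j : Fin N, i ≠ j → δ ≤ dist (x i) (x j)) → ∀ Ω : Finset (Fin N), (∀ i ∈ Ω, IsTwoShellGood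 (1 / 20) (47 / 50) 1 x i) → c * (Nat.card {i : Fin N // i ∈ Ω ∧ ¬ (∃ (A : EuclideanSpace ℝ (Fin 3) →ₗᵢ[ℝ] EuclideanSpace ℝ (Fin 3)) (t : EuclideanSpace ℝ (Fin 3)) (a : ℝ) (s : ℤ → ℤ) (z : ℤ → ℝ), 47 / 50 ≤ a ∧ a ≤ 1 ∧ IsHaggSeq s ∧ (∀ m : ℤ, 39 / 50 * a ≤ z (m + 1) - z m ∧ z (m + 1) - z m ≤ 17 / 20 * a) ∧ (fun S : Set (EuclideanSpace ℝ (Fin 3)) => (∀ j : Fin N, dist (x j) (x i) ≤ 2 → ∃ p ∈ S, dist (x j + t) p ≤ η) ∧ (∀ p ∈ S, dist p (x i + t) ≤ 2 → ∃ j : Fin N, dist (x j + t) p ≤ η)) {p | ∃ m i j : ℤ, p = A (((i : ℝ) • triangularVec₁ a) + ((j : ℝ) • triangularVec₂ a) + ((haggLabel s m : ℝ) • barlowOffset a) + (z m • layerNormal 1))})} : ℝ) - C * (Nat.card {i : Fin N // i ∈ Ω ∧ ∃ j : Fin N, j ∉ Ω ∧ dist (x j) (x i) ≤ 4} : ℝ)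 ≤ (∑ i ∈ Ω, (1 / 2 : ℝ) * (∑ j ∈ Ω.erase i, lennardJones (dist (x i) (x j)))) - (Ω.card : ℝ) * (⨅ Q : PeriodicConfiguration 3, Q.energyPerParticle lennardJones) :=
  fun hchart hIC => pnf_of_interiorCoercivityEStar stub_pairCountOfCrossing hchart hIC

end Summit.AtomisticToContinuum.Crystallization.Theorems.PhononSlackNearFieldConvexity
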